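import Mathlib
import HarnessLib
import Summits.ResolutionOfSingularities.ResolutionOfSingularities.Theorems.WildQuotientsWildQuotientResolutionS1aTerminalReachLower

/-!
# S1a — THE TRANSLATION CLASS (`r = 0`, Artin–Schreier type) IS TERMINAL AT MOVE 0: `R[X]^{X ↦ X + f} = R[X^p − f^{p−1}X]` is regular

[OURS · L1 W4.5c · leafhand-res-wildquotients-9 g1; SUCCESSOR-BRIEF-v2 §3 caveat E-T («every invariant-translation action
`σ x₃ = x₃ + f(x₀, x₁, x₂)` is terminal at move 0 whatever the engine says; test the invariant ring first») and ADDENDUM v2d class taxonomy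
(`r = rank(σ − 1 on 𝔪/𝔪²) = 0`, translation type)] — NOT statements of the manuscript; counted 0; AI-level work, weaker than expert review.
Crux stmt-ResolutionOfSingularities-17941 `CyclicQuotientFourfolds`, line `s1a-logminvertex` v13 (`stub_reachLowerInFX`). A CLASS of the research
stub (the degenerate one: nothing to do), not the stub.

THE ALGEBRA (pure Mathlib, folklore «Artin–Schreier»): `R` a commutative DOMAIN of prime characteristic `p`, `f ∈ R`, and the `R`-algebra
endomorphism `σ : X ↦ X + f` of `R[X]` (`Polynomial.taylor f`). With the NORM `N := ∏_{i ∈ 𝔽_p} (X + i f) = X^p − f^{p−1}·X`: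
* `coeff_taylor_natDegree_pred` / `coeff_taylor_sub_natDegree_pred` — the `X^{d}`-coefficient of `g(X + r) − g(X)` is `(d+1)·lc(g)·r` for `deg g = d+1`
  (Hasse derivative); hence `natCast_natDegree_eq_zero_of_taylor_eq`, `dvd_natDegree_of_taylor_eq`: a `σ`-FIXED polynomial has `p ∣ deg`
  (`f ≠ 0`);
* `taylor_norm_eq`, `monic_norm` — `N` is `σ`-fixed, monic of degree `p`;
* ★ `exists_eq_comp_norm_of_taylor_eq` — every `σ`-fixed `g` is `h(N)` (strong induction on the degree: subtract `lc(g)·N^{deg g / p}`);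
  `comp_norm_injective` — `h ↦ h(N)` is injective; `ringHom_eq_taylor` — a ring endomorphism fixing `R` with `X ↦ X + f` IS `taylor f`;
* ★★ `nonempty_fixedRing_equiv` — THE FIXED RING `{g | σ g = g}` IS RING-ISOMORPHIC TO `R[X]` (for `f = 0` it is all of `R[X]`; for `f ≠ 0` it is
  `R[N] ≅ R[T]`), in particular REGULAR when `R` is (Mathlib `Polynomial.isRegularRing_of_isRegularRing`).
THE CLASS THEOREM (game frame): ★★ `translation_terminal_initial` — for action data `(X′, X₁, q, ρ, g₀)` with `X′` AFFINE, `q` affine, `G = ⟨g₀⟩`,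
and a chart `e : Γ(X′, ⊤) ≃+* R[X]` (`R` a regular domain of characteristic `p`, e.g. `k[x₀,…,x_{n−1}]`) intertwining `g₀` with a ring
endomorphism `σ₀` fixing `R` and translating `X ↦ X + f` — the TRANSLATION TYPE `x_n ↦ x_n + f(x_0,…,x_{n−1})` — the INITIAL MODEL IS TERMINAL
(its ring of invariants `≅ R[T]` is regular: ✓`terminal_initial_of_fixedRing_equiv_regular`), and ★ `exists_reachLowerF_initial_of_translation`:
the datum satisfies the conclusion of `ReachLowerInF(X)` for every root decoration (✓`exists_reachLowerF_of_terminal`, the EMPTY tree). So the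
whole `r = 0` translation stratum of the census inhabits the research stub at depth `0`, although its fixed locus `{f = 0}` is non-empty
(caveat E-T: `KillsIn 0` is the wrong test there).
-/

set_option linter.dupNamespace false

noncomputable section

open CategoryTheory Limits AlgebraicGeometry TopologicalSpace Topology
open Literature.AlgebraicGeometry.Resolution Literature.AlgebraicGeometry.RelativeSpec
open Summit.ResolutionOfSingularities.ResolutionOfSingularities.Theorems.WildQuotientResolution.S1
open Summit.ResolutionOfSingularities.ResolutionOfSingularities.Theorems.WildQuotientResolution.S1.NodeAtlas
open Summit.ResolutionOfSingularities.ResolutionOfSingularities.Theorems.WildQuotientResolution.S1.NpFrame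

namespace Summit.ResolutionOfSingularities.ResolutionOfSingularities.Theorems.WildQuotientResolution.S1.TranslationClass

open Polynomial

variable {R : Type*} [CommRing R]

/-- The coefficient of `X^d` in `g(X + r)` for `g` of degree `d + 1`: `g_d + (d+1)·lc(g)·r`. [folklore] -/
theorem coeff_taylor_natDegree_pred (r : R) (g : R[X]) (d : ℕ) (hg : g.natDegree = d + 1) :
    (taylor r g).coeff d = g.coeff d + ((d + 1 : ℕ) : R) * g.coeff (d + 1) * r := by
  rw [taylor_coeff]
  have hdeg : (hasseDeriv d g).natDegree < 2 := by
    have := natDegree_hasseDeriv_le g d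
    omega
  rw [eval_eq_sum_range' hdeg, Finset.sum_range_succ, Finset.sum_range_one, hasseDeriv_coeff, hasseDeriv_coeff]
  simp only [zero_add, Nat.choose_self, Nat.cast_one, one_mul, pow_zero, mul_one, pow_one]
  rw [show 1 + d = d + 1 by ring, Nat.choose_succ_self_right]

/-- `g(X + r) − g` has `X^d`-coefficient `(d+1)·lc(g)·r` when `deg g = d + 1`. [folklore] -/
theorem coeff_taylor_sub_natDegree_pred (r : R) (g : R[X]) (d : ℕ) (hg : g.natDegree = d + 1) :
    (taylor r g - g).coeff d = ((d + 1 : ℕ) : R) * g.coeff (d + 1) * r := by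
  rw [coeff_sub, coeff_taylor_natDegree_pred r g d hg]; ring

/-- Over a domain, a non-constant polynomial fixed by the translation `X ↦ X + r`, `r ≠ 0`, has degree `≡ 0` in `R`:
`(deg g : R) = 0`. [folklore] -/
theorem natCast_natDegree_eq_zero_of_taylor_eq [IsDomain R] {r : R} (hr : r ≠ 0) {g : R[X]} (hfix : taylor r g = g)
    (hg : 0 < g.natDegree) : ((g.natDegree : ℕ) : R) = 0 := by
  obtain ⟨d, hd⟩ : ∃ d, g.natDegree = d + 1 := ⟨g.natDegree - 1, by omega⟩
  have h := coeff_taylor_sub_natDegree_pred r g d hd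
  rw [hfix, sub_self, coeff_zero] at h
  have hlc : g.coeff (d + 1) ≠ 0 := by
    rw [← hd]
    exact fun h0 => by
      rw [coeff_natDegree, leadingCoeff_eq_zero] at h0
      rw [h0, natDegree_zero] at hg
      exact lt_irrefl 0 hg
  rw [hd]
  rcases mul_eq_zero.mp h.symm with h1 | h1
  · rcases mul_eq_zero.mp h1 with h2 | h2
    · exact h2
    · exact absurd h2 hlc
  · exact absurd h1 hr

/-- In characteristic `p`: a polynomial fixed by `X ↦ X + r`, `r ≠ 0`, over a domain has `p ∣ deg g`. [folklore] -/
theorem dvd_natDegree_of_taylor_eq [IsDomain R] (p : ℕ) [CharP R p] {r : R} (hr : r ≠ 0) {g : R[X]}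
    (hfix : taylor r g = g) : p ∣ g.natDegree := by
  by_cases hg : g.natDegree = 0
  · rw [hg]; exact dvd_zero p
  · exact (CharP.cast_eq_zero_iff R p _).mp (natCast_natDegree_eq_zero_of_taylor_eq hr hfix (Nat.pos_of_ne_zero hg))

/-- The Artin–Schreier norm `N = X^p − f^{p−1}·X = ∏_{i ∈ 𝔽_p} (X + i f)` is fixed by `X ↦ X + f` in characteristic `p`. [folklore] -/
theorem taylor_norm_eq (p : ℕ) (hp : p.Prime) [CharP R p] (f : R) :
    taylor f (X ^ p - C (f ^ (p - 1)) * X : R[X]) = X ^ p - C (f ^ (p - 1)) * X := by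
  haveI := Fact.mk hp
  rw [taylor_apply, sub_comp, X_pow_comp, mul_comp, C_comp, X_comp, add_pow_char, mul_add, ← C_pow, ← C_mul,
    pow_sub_one_mul hp.ne_zero f]
  ring

/-- `N = X^p − f^{p−1}·X` is monic of degree `p` (`p` prime). [folklore] -/
theorem monic_norm (p : ℕ) (hp : p.Prime) (f : R) [Nontrivial R] :
    (X ^ p - C (f ^ (p - 1)) * X : R[X]).Monic ∧ (X ^ p - C (f ^ (p - 1)) * X : R[X]).natDegree = p := by
  have hlt : (C (f ^ (p - 1)) * X : R[X]).degree < (p : WithBot ℕ) := by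
    refine (degree_C_mul_X_le _).trans_lt ?_
    exact_mod_cast hp.one_lt
  refine ⟨monic_X_pow_sub hlt, ?_⟩
  rw [natDegree_sub_eq_left_of_natDegree_lt] <;> rw [natDegree_X_pow]
  exact ((natDegree_C_mul_le _ _).trans natDegree_X_le).trans_lt hp.one_lt

/-- **Fixed polynomials of the Artin–Schreier translation are polynomials in the norm.** Over a domain `R` of characteristic `p`,
every `g ∈ R[X]` with `g(X + f) = g(X)`, `f ≠ 0`, is `h(N)` for some `h ∈ R[X]`, `N = X^p − f^{p−1}X`. [folklore: `R[X]^{ℤ/p} = R[N]`] -/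
theorem exists_eq_comp_norm_of_taylor_eq [IsDomain R] (p : ℕ) (hp : p.Prime) [CharP R p] {f : R} (hf : f ≠ 0) :
    ∀ g : R[X], taylor f g = g → ∃ h : R[X], g = h.comp (X ^ p - C (f ^ (p - 1)) * X) := by
  intro g
  induction' hn : g.natDegree using Nat.strong_induction_on with n ih generalizing g
  intro hfix
  subst hn
  by_cases hg0 : g.natDegree = 0
  · exact ⟨C (g.coeff 0), by rw [C_comp, ← eq_C_of_natDegree_eq_zero hg0]⟩
  have hgne : g ≠ 0 := fun h => hg0 (by rw [h, natDegree_zero])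
  obtain ⟨m, hm⟩ := dvd_natDegree_of_taylor_eq p hf hfix
  obtain ⟨hmon, hdeg⟩ := monic_norm (R := R) p hp f
  set N : R[X] := X ^ p - C (f ^ (p - 1)) * X with hN
  have hm0 : 0 < m := Nat.pos_of_ne_zero fun h => hg0 (by rw [hm, h, mul_zero])
  -- subtract the top term `lc(g) · N^m`
  set g' : R[X] := g - C g.leadingCoeff * N ^ m with hg'
  have hNm : (N ^ m).Monic := hmon.pow m
  have hNmdeg : (N ^ m).natDegree = g.natDegree := by rw [hmon.natDegree_pow, hdeg, hm, mul_comm]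
  have hlc : g.leadingCoeff ≠ 0 := leadingCoeff_ne_zero.mpr hgne
  have hdeg' : (C g.leadingCoeff * N ^ m).degree = g.degree := by
    rw [degree_C_mul hlc, degree_eq_natDegree hNm.ne_zero, hNmdeg, degree_eq_natDegree hgne]
  have hlc' : g.leadingCoeff = (C g.leadingCoeff * N ^ m).leadingCoeff := by
    rw [leadingCoeff_mul, leadingCoeff_C, hNm.leadingCoeff, mul_one]
  have hlt : g'.natDegree < g.natDegree := by
    by_cases h0 : g' = 0
    · rw [h0, natDegree_zero]; exact Nat.pos_of_ne_zero hg0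
    · exact natDegree_lt_natDegree h0 (hg' ▸ degree_sub_lt hdeg'.symm hgne hlc')
  have hNfix : taylor f N = N := taylor_norm_eq p hp f
  have hfix' : taylor f g' = g' := by
    rw [hg', map_sub, hfix, taylor_apply, mul_comp, C_comp, pow_comp, ← taylor_apply, hNfix]
  obtain ⟨h, hh⟩ := ih g'.natDegree hlt g' rfl hfix'
  refine ⟨h + C g.leadingCoeff * X ^ m, ?_⟩
  rw [add_comp, mul_comp, C_comp, X_pow_comp, ← hh, hg']
  ring

/-- `h ↦ h(N)` is injective (`R` a domain, `N` non-constant). [folklore] -/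
theorem comp_norm_injective [IsDomain R] (p : ℕ) (hp : p.Prime) (f : R) :
    Function.Injective fun h : R[X] => h.comp (X ^ p - C (f ^ (p - 1)) * X) := by
  obtain ⟨hmon, hdeg⟩ := monic_norm (R := R) p hp f
  intro h₁ h₂ h12
  have h0 : (h₁ - h₂).comp (X ^ p - C (f ^ (p - 1)) * X) = 0 := by
    rw [sub_comp]; exact sub_eq_zero.mpr h12
  rcases comp_eq_zero_iff.mp h0 with h | ⟨-, h⟩
  · exact sub_eq_zero.mp h
  · have := congrArg natDegree h
    rw [hdeg, natDegree_C] at this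
    exact absurd this hp.ne_zero

/-- A ring endomorphism of `R[X]` fixing `R` and sending `X ↦ X + f` is the Taylor translation. [folklore] -/
theorem ringHom_eq_taylor (σ : R[X] →+* R[X]) (hC : ∀ r : R, σ (C r) = C r) (f : R) (hX : σ X = X + C f) (g : R[X]) :
    σ g = taylor f g := by
  have : σ = (taylorAlgHom f : R[X] →ₐ[R] R[X]).toRingHom := by
    refine Polynomial.ringHom_ext (fun a => ?_) ?_
    · rw [hC]; exact (taylor_C f a).symm
    · rw [hX]; exact (taylor_X f).symm
  rw [this]; rfl


/-- ★★ **THE FIXED RING OF THE ARTIN–SCHREIER TRANSLATION IS A POLYNOMIAL RING.** Let `R` be a domain of prime characteristic `p`, `f ∈ R`, and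
`σ` a ring endomorphism of `R[X]` fixing `R` with `σ X = X + f`. Then `{g | σ g = g} ≃+* R[X]`: for `f = 0` the fixed ring is everything, for
`f ≠ 0` it is `R[N]`, `N = X^p − f^{p−1}X`, and `h ↦ h(N)` is an isomorphism onto it. [folklore: `R[X]^{ℤ/p} = R[N]`] -/
theorem nonempty_fixedRing_equiv [IsDomain R] (p : ℕ) (hp : p.Prime) [CharP R p] (f : R) (σ : R[X] →+* R[X])
    (hC : ∀ r : R, σ (C r) = C r) (hX : σ X = X + C f) :
    Nonempty (↥(RingHom.eqLocus σ (RingHom.id R[X])) ≃+* R[X]) := by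
  by_cases hf : f = 0
  · -- `σ = id`: the fixed ring is all of `R[X]`
    have hσ : ∀ g, σ g = g := fun g => by rw [ringHom_eq_taylor σ hC f hX g, hf, taylor_zero]
    have htop : RingHom.eqLocus σ (RingHom.id R[X]) = ⊤ :=
      eq_top_iff.mpr fun g _ => by rw [RingHom.mem_eqLocus, RingHom.id_apply]; exact hσ g
    exact ⟨(RingEquiv.subringCongr htop).trans Subring.topEquiv⟩
  · -- `f ≠ 0`: `h ↦ h(N)` is a ring isomorphism `R[X] ≃ R[N] = fixed ring`
    set N : R[X] := X ^ p - C (f ^ (p - 1)) * X with hN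
    have hfixN : σ N = N := by rw [ringHom_eq_taylor σ hC f hX, taylor_norm_eq p hp f]
    let φ : R[X] →+* R[X] := (aeval N : R[X] →ₐ[R] R[X]).toRingHom
    have hφ : ∀ h : R[X], φ h = h.comp N := fun h => (comp_eq_aeval (p := h) (q := N)).symm
    have hmem : ∀ h : R[X], φ h ∈ RingHom.eqLocus σ (RingHom.id R[X]) := fun h => by
      rw [RingHom.mem_eqLocus, RingHom.id_apply, hφ, ringHom_eq_taylor σ hC f hX, taylor_apply, comp_assoc, ← taylor_apply,
        ← ringHom_eq_taylor σ hC f hX, hfixN]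
    refine ⟨(RingEquiv.ofBijective (φ.codRestrict _ hmem) ⟨fun h₁ h₂ h12 => ?_, fun g => ?_⟩).symm⟩
    · have h12' : φ h₁ = φ h₂ := congrArg Subtype.val h12
      rw [hφ, hφ] at h12'
      exact comp_norm_injective p hp f h12'
    · have hg : taylor f g.1 = g.1 := by
        rw [← ringHom_eq_taylor σ hC f hX]
        exact g.2
      obtain ⟨h, hh⟩ := exists_eq_comp_norm_of_taylor_eq p hp hf g.1 hg
      exact ⟨h, Subtype.ext (by rw [RingHom.codRestrict_apply, hφ, ← hh])⟩

end Summit.ResolutionOfSingularities.ResolutionOfSingularities.Theorems.WildQuotientResolution.S1.TranslationClass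

namespace Summit.ResolutionOfSingularities.ResolutionOfSingularities.Theorems.WildQuotientResolution.S1.GameFrame.GModel

open Polynomial

variable {p : ℕ} {X' X₁ : Scheme.{0}} {q : X' ⟶ X₁} {G : Type} [Group G] {ρ : G →* Aut X'} {g₀ : G}

/-- ★★ **THE TRANSLATION CLASS IS TERMINAL AT MOVE 0.** Let `(X′, X₁, q, ρ, g₀)` be action data with `X′` AFFINE, integral and locally Noetherian,
`q` affine and `G`-invariant, `G = ⟨g₀⟩`, and let `e : Γ(X′, ⊤) ≃+* R[X]` — `R` a REGULAR DOMAIN of characteristic `p` (e.g. `k[x₀,…,x_{n−1}]`) —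
intertwine the action of `g₀` on global sections (pull-back along `g₀⁻¹`) with a ring endomorphism `σ₀` of `R[X]` fixing `R` and TRANSLATING
`X ↦ X + f` (`f ∈ R`; the type `x_n ↦ x_n + f(x₀,…,x_{n−1})`, all other variables fixed). Then the INITIAL MODEL IS TERMINAL: its ring of
invariants is `R[X]^{σ₀} ≅ R[T]`, a regular ring. [OURS · L1 W4.5c · class `r = 0` translation / caveat E-T; NOT a statement of the manuscript] -/
theorem translation_terminal_initial [Finite G] (hG : ∀ g : G, g ∈ Subgroup.zpowers g₀)
    (hq : ∀ g : G, (ρ g).hom ≫ q = q) [IsIntegral X'] [IsLocallyNoetherian X'] [IsAffine X'] [IsAffineHom q]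
    {R : Type} [CommRing R] [IsDomain R] [IsRegularRing R] [CharP R p] (hp : p.Prime) (f : R)
    (σ₀ : R[X] →+* R[X]) (hC : ∀ r : R, σ₀ (C r) = C r) (hX : σ₀ X = X + C f)
    (e : Γ(X', ⊤) ≃+* R[X])
    (he : ∀ t : Γ(X', ⊤), e ((ρ g₀⁻¹).hom.appLE ⊤ ⊤ (by rw [Scheme.Hom.preimage_top]) t) = σ₀ (e t))
    (h₀ : NodeAtlas p (⟨ρ, hq⟩ : ActionOver q G) g₀) :
    (GModel.initial (p := p) (g₀ := g₀) hq h₀).Terminal := by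
  obtain ⟨eR⟩ := TranslationClass.nonempty_fixedRing_equiv p hp f σ₀ hC hX
  exact terminal_initial_of_fixedRing_equiv_regular hG hq e σ₀ he eR h₀

/-- ★ **THE TRANSLATION CLASS INHABITS THE RESEARCH STUB (depth 0).** In the setting of `translation_terminal_initial`, the conclusion of
`ReachLowerInF(X)` holds at the initial model for EVERY root decoration `𝔄₀` (✓`exists_reachLowerF_of_terminal`: the class `{Terminal}`, the empty
tree) — although the fixed locus `{f = 0}` may be non-empty. [OURS · L1 W4.5c · class `r = 0` translation; NOT a statement of the manuscript] -/
theorem exists_reachLowerF_initial_of_translation [Finite G] (hG : ∀ g : G, g ∈ Subgroup.zpowers g₀)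
    (hq : ∀ g : G, (ρ g).hom ≫ q = q) [IsIntegral X'] [IsLocallyNoetherian X'] [IsAffine X'] [IsAffineHom q]
    {R : Type} [CommRing R] [IsDomain R] [IsRegularRing R] [CharP R p] (hp : p.Prime) (f : R)
    (σ₀ : R[X] →+* R[X]) (hC : ∀ r : R, σ₀ (C r) = C r) (hX : σ₀ X = X + C f)
    (e : Γ(X', ⊤) ≃+* R[X])
    (he : ∀ t : Γ(X', ⊤), e ((ρ g₀⁻¹).hom.appLE ⊤ ⊤ (by rw [Scheme.Hom.preimage_top]) t) = σ₀ (e t))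
    (h₀ : NodeAtlas p (⟨ρ, hq⟩ : ActionOver q G) g₀) (𝔄₀ : NodeAtlasData p (GModel.initial hq h₀).act g₀) :
    ∃ P : ∀ M : GModel p q G ρ g₀, NodeAtlasData p M.act g₀ → Prop,
      P (GModel.initial hq h₀) 𝔄₀ ∧ ∀ (M : GModel p q G ρ g₀) (𝔄 : NodeAtlasData p M.act g₀), P M 𝔄 → ¬ M.Terminal →
        ∃ n : ℕ, TreeF P (fun N 𝔅 => LexLTF N 𝔅 M 𝔄) n M 𝔄 :=
  exists_reachLowerF_of_terminal _ 𝔄₀ (translation_terminal_initial hG hq hp f σ₀ hC hX e he h₀)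

end Summit.ResolutionOfSingularities.ResolutionOfSingularities.Theorems.WildQuotientResolution.S1.GameFrame.GModel

end
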